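import Summits.QuantumFields.BalabanUV.T4Continuum.Support.NE3ProductPathChart
import Summits.QuantumFields.BalabanUV.T4Continuum.Support.NE3CpushGaugeCovariance
import Summits.QuantumFields.BalabanUV.T4Continuum.Support.NE3FrameFreeSliceW
import Summits.QuantumFields.BalabanUV.T4Continuum.Support.AveragingDeficitMultiLevelBridge
import Summits.QuantumFields.BalabanUV.T4Continuum.Support.BlockAverageCurrent
import Summits.QuantumFields.BalabanUV.T4Continuum.Support.AveragingDeficitKDatum
import Summits.QuantumFields.BalabanUV.T4Continuum.Support.BlockAverageLogInteraction
import HarnessLib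

/-!
# T⁴ programme, node NE3 — route Π, row Π-L1♮ RE-TYPED (ruling ρ-g25-1): THE RESIDUAL SLICE REPRESENTATIVE OF A PAIR, and the
# kernel glue from it to the algebraic half of `DecomposedRep` (representation `U_A^u = W·e^{N}·e^{−X}`, tangent datum `X ∈ T_♮(W)`,
# the normal part `N` and its pointwise comparison with the linear normal part)

NE3 (node U1b), row NE3 OWNER `b2b-balaban-t4-ne3-p1` (gen 25); design `D-ne3p1-g24-1.md` §§5–6 as corrected by ruling ρ-g25-1 (journal)
and `D-ne3p1-g25-1.md`.  Inputs BY NAME: `NE3ProductPathChart.DecomposedRep` (p237527), leaf-01-g7's `NE3CpushGaugeCovariance.cavgIter_gaugeAct`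
(finite gauge covariance of the iterated average), K0b's slice `NE3FrameFreeSliceW.frameFreeBlockLandauW` and `cornerGaugeSpaceW` (Ξ₀₀(W)),
the tower kit `NE3TangentCovariantTower.dirIter`∕`framePotW`∕`tangentIter_iff_dirIter_eq_zero`∕`dirIter_add`, `NE3CurvedFrameKill.framePotW_add`,
leaf-10's bilinear logarithm `BlockAverageLogInteraction.logK`∕`norm_logK_one_one_le`.

WHY THIS FILE.  The gauge transformation `u` of the endpoint chart is free (`EndpointChart.rep` asks only `U_A^u = W·e^{Γ 0}`).  The natural
choice is the RESIDUAL gauge group of the constrained variational problem: `u` CORNER-TRIVIAL, `u(L^k·z) = 1` — its Lie algebra is exactly the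
corner-trivial generators Ξ₀ of K0b's decomposition `ker D_W = T_♮(W) ⊕ gaugeDir W (Ξ₀)`, and it preserves the fibre EXACTLY:
`cavgIter L k (U_A^u) = (cavgIter L k U_A)^{u∘(L^k•)} = V` (§2).  Hence the relative field `X₀ := log(W⁻¹U_A^u)` of a residual representative
satisfies the NON-LINEAR fibre equation `cavgIter L k (W·e^{X₀}) = cavgIter L k W` with NO coarse pure-gauge term, so that its linearised
average `D_W X₀` is (minus) the quadratic remainder of the average ALONE (route Π's Π-C, leaf-02-g7).  If moreover `X₀` satisfies the two
LINEAR slice conditions (frame-free, `hsR`-orthogonal to `gaugeDir W (Ξ₀₀(W))`) and the normal part `Nn` (any field with the same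
linearised average, frame-free and orthogonal as well — route Π's smooth right inverse Π-R applied to `D_W X₀`, leaf-01-g7) is subtracted,
the difference `X := Nn − X₀` lies in `T_♮(W)` AUTOMATICALLY (§3), and the exact product split `e^{X₀} = e^{N}·e^{−X}` with
`N := log(e^{X₀}·e^{X}) = Nn + logK X Nn 1 1` has `‖N − Nn‖ ≤ 2048·‖X‖·‖Nn‖` bondwise (§4) — the `rep`∕`tangent`∕`skew`∕`per`∕`sup` half
of `DecomposedRep`.  The three SIZES (ν, κ₁, κ₂) and the plaquette radius are the analytic half (Π-C sup form × Π-R letters × (Π-REG)),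
assembled in a later file.

CONTENT (0 sorry):
§1 shape `ResidualSliceRep L N k W UA u X₀ α₀` [Π-L1♮ re-typed: B11 Prop. 2 TYPE-analogue in the residual gauge group — OURS; asserted for
   nothing; its kernel discharge (inverse-function theorem on the residual group, derivative `Id + O(√(dL)·α̂₀)` in `‖gaugeDir W ·‖_ℓ²`)
   needs block-scale L^∞ regularity to stay in the sup-ball and is NOT attempted — ρ-g25-1 (3)].
§2 `isPeriodicCfg_gaugeAct`, `mem_sfClass_gaugeAct` (the class is gauge invariant), **`cavgIter_gaugeAct_of_cornerTrivial`** (residual gauges fix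
   the iterated average), `mem_admissible_gaugeAct` (they preserve admissibility), **`cavgIter_vary_eq_of_residualSliceRep`** (the non-linear
   fibre equation of the relative field).
§3 `dirIter_sub`, `framePotW_sub`, **`sub_mem_frameFreeBlockLandauW`** (`Nn − X₀ ∈ T_♮(W)`).
§4 `normalPart`, `normalPart_eq_add_logK`, **`norm_normalPart_sub_le`** (`‖N − Nn‖ ≤ 2048‖X‖‖Nn‖`), `norm_normalPart_le`,
   **`exp_normalPart_mul_exp_neg`** (`e^{N}·e^{−X} = e^{X₀}`), `normalPart_skew`, **`rep_of_residualSliceRep`** (`U_A^u = W·e^{N}·e^{−X}` bondwise).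

HONEST FRAMING.  Bookkeeping (gauge covariance, linear algebra of the slice, one bilinear logarithm estimate BY NAME); the shape
`ResidualSliceRep` is a HYPOTHESIS asserted for nothing; the sizes of `DecomposedRep`, (P♮)_W's numeric lines, (H∃), T-E_w♯ and NE3 are NOT
proved here; spine PROVED 0∕9; finite T⁴ rung (B)+1 — NOT infinite volume, NOT mass gap, NOT `BetaPertH`, NOT Clay.  ABSOLUTE RULE kept (no
printed sentence is a hypothesis; context: [Balaban1985Variational] Prop. 2 p. 281, (75)–(77) p. 289; [Balaban1985Averaging] (45) p. 24).
PLACEMENT: `Summits/QuantumFields/BalabanUV/`.  HONEST DEPENDENCY: continuum YM on T⁴ ⇐ BetaPertH ∧ nine spine estimates (0/9 proved);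
BetaPertH ⇐ (D1) ∧ (D4) ∧ CAP+tail; G-an2-4 gates asym, D1 and NE2/3/4.
-/

set_option autoImplicit false

open scoped BigOperators Matrix.Norms.L2Operator
open NormedSpace Finset

namespace Summit.QuantumFields.BalabanUV.T4Continuum.NE3ResidualSliceRep

open Literature.MathematicalPhysics.QuantumFieldTheory.Balaban1983to89
open B7Prop1Explicit B7Prop2Explicit MatrixLog
open T4AveragingDeficitWall (IsSkewDir IsUnitaryCfg SmallField vary)
open T4AveragingDeficitWallBoundary (IsPeriodicCfg periodBox)
open AveragingDeficitPeriodicCounting (IsPeriodicDir)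
open AveragingDeficitChartCalculus (cavg)
open AveragingDeficitMultiLevelPrep (cavgIter TangentIter tower LevelSmall)
open AveragingDeficitMultiLevelBridge (cavgIter_eq_avgIter)
open AveragingDeficitKDatum (isUnitaryCfg_gaugeAct)
open BlockAverageCurrent (smallField_gaugeAct)
open BlockAveragePushDirGauge (gaugeDir gaugeAct_const_one)
open MinimalActionSandwich (admissible)
open MinimalActionRate (sfClass)
open NE3EnergyShapes (IsUnitarySite IsPeriodicSite)
open NE3CovariantCalculus (hsR hsR_sub_left)
open NE3TangentCovariantTower (dirIter framePotW tangentIter_iff_dirIter_eq_zero dirIter_add)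
open NE3CurvedFrameKill (framePotW_add)
open NE3FrameFreeSliceW (frameFreeBlockLandauW cornerGaugeSpaceW)
open NE3EnergyRateWSupOfSlicePoincare (tower_eq_mul_pow)
open NE3CpushGaugeCovariance (cavgIter_gaugeAct)
open BlockAverageLogInteraction (logK norm_logK_one_one_le)
open NE3EnergyPathC2 (exp_mul_exp_neg_eq_one)
open NE3ProductPath (exp_real_smul_mem_unitary)

noncomputable section

variable {d : ℕ} {n : Type*} [Fintype n] [DecidableEq n]

/-! ## §1 The shape: a residual slice representative of the pair -/

/-- **Π-L1♮ — THE RESIDUAL SLICE REPRESENTATIVE OF A PAIR** at level `k` with background `W` (period `N·L^k`): a unitary periodic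
gauge transformation `u` that is CORNER-TRIVIAL (`u(L^k·z) = 1`: the residual gauge group of the constrained problem), the relative field
`X₀` with `U_A^u = W·e^{X₀}`, skew, periodic, of sup-size `α₀`, satisfying the two LINEAR slice conditions: frame-free and
`hsR`-orthogonal over the period box to the gauge directions of `Ξ₀₀(W)`.  A hypothesis SHAPE, asserted for nothing (B11 Prop. 2
TYPE-analogue in the residual group; ours). [folklore] -/
@[folklore]
structure ResidualSliceRep (L N k : ℕ) (W UA : Site d → Fin d → (Matrix n n ℂ)ˣ) (u : Site d → (Matrix n n ℂ)ˣ) (X₀ : Site d → Fin d → (Matrix n n ℂ)) (α₀ : ℝ) :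
    Prop where
  /-- the gauge transformation is `U(N)`-valued and periodic -/
  gauge : IsUnitarySite u ∧ IsPeriodicSite u ((N * L ^ k : ℕ) : ℤ)
  /-- RESIDUAL: the gauge transformation is trivial at the block corners of level `k` -/
  cornerTrivial : ∀ z : Site d, u (((L : ℤ) ^ k) • z) = 1
  /-- the representation `U_A^u = W·e^{X₀}` -/
  rep : gaugeAct u UA = vary W X₀ 1
  /-- the relative field is skew -/
  skew : IsSkewDir X₀
  /-- the relative field is periodic -/
  per : IsPeriodicDir X₀ ((N * L ^ k : ℕ) : ℤ)
  /-- the sup datum is non-negative -/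
  hα₀ : 0 ≤ α₀
  /-- sup bound of the relative field -/
  sup : ∀ (x : Site d) (μ : Fin d), ‖X₀ x μ‖ ≤ α₀
  /-- SLICE CONDITION 1: the relative field is frame-free -/
  frameFree : ∀ z : Site d, framePotW L k W X₀ z = 0
  /-- SLICE CONDITION 2: the relative field is `hsR`-orthogonal to the gauge directions of `Ξ₀₀(W)` -/
  orth : ∀ μ ∈ cornerGaugeSpaceW (d := d) (n := n) L k W (tower L N k) (L ^ k),
    ∑ x ∈ periodBox (d := d) (tower L N k), ∑ κ : Fin d, hsR (X₀ x κ) (gaugeDir W μ x κ) = 0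

/-! ## §2 Residual gauges preserve the fibre exactly -/

/-- A gauge transform by a `P`-periodic site field of a `P`-periodic configuration is `P`-periodic. [folklore] -/
theorem isPeriodicCfg_gaugeAct {u : Site d → (Matrix n n ℂ)ˣ} {P : ℤ} (hu : IsPeriodicSite u P) {U : Site d → Fin d → (Matrix n n ℂ)ˣ}
    (hU : IsPeriodicCfg U P) : IsPeriodicCfg (gaugeAct u U) P := by
  intro x κ μ
  simp only [gaugeAct]
  rw [hu x κ, hU x κ μ, add_right_comm, hu (x + e μ) κ]

/-- **THE SMALL-FIELD CLASS IS GAUGE INVARIANT**: `U ∈ sfClass d L N ε k`, `u` unitary and `(N·L^k)`-periodic ⟹ `U^u ∈ sfClass d L N ε k`.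
[folklore] -/
theorem mem_sfClass_gaugeAct [Nonempty n] {L N : ℕ} {ε : ℝ} {k : ℕ} {u : Site d → (Matrix n n ℂ)ˣ} (hu : IsUnitarySite u)
    (huP : IsPeriodicSite u ((N * L ^ k : ℕ) : ℤ)) {U : Site d → Fin d → (Matrix n n ℂ)ˣ} (hU : U ∈ sfClass d L N ε k) :
    gaugeAct u U ∈ sfClass d L N ε k :=
  ⟨isUnitaryCfg_gaugeAct hu hU.1, isPeriodicCfg_gaugeAct huP hU.2.1, smallField_gaugeAct hu hU.2.2⟩

/-- **RESIDUAL GAUGES FIX THE ITERATED AVERAGE** (multi-level small-field class): for `u` unitary and corner-trivial at scale `L^{j+1}`,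
`cavgIter L (j+1) (U^u) = cavgIter L (j+1) U`. [folklore] -/
theorem cavgIter_gaugeAct_of_cornerTrivial [Nonempty n] {L : ℕ} (hL : 1 ≤ L) (j : ℕ) {U : Site d → Fin d → (Matrix n n ℂ)ˣ} {x : ℝ}
    (hUu : IsUnitaryCfg U) (hx : 0 ≤ x) (hs : LevelSmall d L j x) (hUx : SmallField U x)
    {u : Site d → (Matrix n n ℂ)ˣ} (hu : IsUnitarySite u) (hc : ∀ z : Site d, u (((L : ℤ) ^ (j + 1)) • z) = 1) :
    cavgIter L (j + 1) (gaugeAct u U) = cavgIter L (j + 1) U := by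
  rw [cavgIter_gaugeAct hL j hUu hx hs hUx hu]
  have h1 : (fun w : Site d => u (((L : ℤ) ^ (j + 1)) • w)) = fun _ => (1 : (Matrix n n ℂ)ˣ) := funext fun w => hc w
  rw [h1, gaugeAct_const_one]

/-- **RESIDUAL GAUGES PRESERVE ADMISSIBILITY**: `U_A ∈ admissible (sfClass d L N ε) L (j+1) V`, `u` unitary, periodic and corner-trivial
⟹ `U_A^u ∈ admissible (sfClass d L N ε) L (j+1) V` — the constraint `avgIter L · (j+1) = V` is kept EXACTLY. [folklore] -/
theorem mem_admissible_gaugeAct [Nonempty n] {L N : ℕ} (hL : 1 ≤ L) {ε : ℝ} (j : ℕ) (hε : 0 ≤ ε)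
    (hs : LevelSmall d L j (ε / ((L : ℝ) ^ (j + 1)) ^ 2)) {V UA : Site d → Fin d → (Matrix n n ℂ)ˣ}
    (hA : UA ∈ admissible (sfClass d L N ε) L (j + 1) V) {u : Site d → (Matrix n n ℂ)ˣ} (hu : IsUnitarySite u)
    (huP : IsPeriodicSite u ((N * L ^ (j + 1) : ℕ) : ℤ)) (hc : ∀ z : Site d, u (((L : ℤ) ^ (j + 1)) • z) = 1) :
    gaugeAct u UA ∈ admissible (sfClass d L N ε) L (j + 1) V := by
  obtain ⟨hcl, havg⟩ := hA
  refine ⟨mem_sfClass_gaugeAct hu huP hcl, ?_⟩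
  have hx : 0 ≤ ε / ((L : ℝ) ^ (j + 1)) ^ 2 := by positivity
  rw [← cavgIter_eq_avgIter, cavgIter_gaugeAct_of_cornerTrivial hL j hcl.1 hx hs hcl.2.2 hu hc, cavgIter_eq_avgIter]
  exact havg

/-- **THE NON-LINEAR FIBRE EQUATION OF THE RELATIVE FIELD**: for a residual slice representative of `(U_A, W)` with `U_A` admissible for
run `j+1` at datum `V`, `cavgIter L (j+1) (W·e^{X₀}) = V`; if also `W` is admissible, `cavgIter L (j+1) (W·e^{X₀}) = cavgIter L (j+1) W`.
[folklore] -/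
theorem cavgIter_vary_eq_of_residualSliceRep [Nonempty n] {L N : ℕ} (hL : 1 ≤ L) {ε : ℝ} (j : ℕ) (hε : 0 ≤ ε)
    (hs : LevelSmall d L j (ε / ((L : ℝ) ^ (j + 1)) ^ 2)) {V UA W : Site d → Fin d → (Matrix n n ℂ)ˣ}
    (hA : UA ∈ admissible (sfClass d L N ε) L (j + 1) V) (hW : W ∈ admissible (sfClass d L N ε) L (j + 1) V)
    {u : Site d → (Matrix n n ℂ)ˣ} {X₀ : Site d → Fin d → (Matrix n n ℂ)} {α₀ : ℝ} (h : ResidualSliceRep L N (j + 1) W UA u X₀ α₀) :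
    cavgIter L (j + 1) (vary W X₀ 1) = V ∧ cavgIter L (j + 1) (vary W X₀ 1) = cavgIter L (j + 1) W := by
  have h1 := mem_admissible_gaugeAct hL j hε hs hA h.gauge.1 h.gauge.2 h.cornerTrivial
  rw [h.rep] at h1
  have h2 : cavgIter L (j + 1) (vary W X₀ 1) = V := by rw [cavgIter_eq_avgIter]; exact h1.2
  have h3 : cavgIter L (j + 1) W = V := by rw [cavgIter_eq_avgIter]; exact hW.2
  exact ⟨h2, h2.trans h3.symm⟩

/-! ## §3 Subtracting the normal part lands in the slice -/

/-- Subtractivity of the linearised `(j+1)`-fold average (from additivity). [folklore] -/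
theorem dirIter_sub [Nonempty n] {L : ℕ} (hL : 1 ≤ L) (j : ℕ) {W : Site d → Fin d → (Matrix n n ℂ)ˣ} {x : ℝ} (hWu : IsUnitaryCfg W)
    (hx : 0 ≤ x) (hs : LevelSmall d L j x) (hWx : SmallField W x) (A B : Site d → Fin d → (Matrix n n ℂ)) :
    dirIter L (j + 1) W (fun y μ => A y μ - B y μ) = fun z κ => dirIter L (j + 1) W A z κ - dirIter L (j + 1) W B z κ := by
  have h := dirIter_add hL j hWu hx hs hWx (fun y μ => A y μ - B y μ) B
  have hAB : (fun y μ => (fun y μ => A y μ - B y μ) y μ + B y μ) = A := by funext y μ; simp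
  rw [hAB] at h
  funext z κ
  rw [h]
  exact (add_sub_cancel_right _ _).symm

/-- Subtractivity of the accumulated frame generator (from additivity). [folklore] -/
theorem framePotW_sub [Nonempty n] {L : ℕ} (hL : 1 ≤ L) (j : ℕ) {W : Site d → Fin d → (Matrix n n ℂ)ˣ} {x : ℝ} (hWu : IsUnitaryCfg W)
    (hx : 0 ≤ x) (hs : LevelSmall d L j x) (hWx : SmallField W x) (A B : Site d → Fin d → (Matrix n n ℂ)) (z : Site d) :
    framePotW L (j + 1) W (fun y μ => A y μ - B y μ) z = framePotW L (j + 1) W A z - framePotW L (j + 1) W B z := by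
  have h := framePotW_add hL j hWu hx hs hWx (fun y μ => A y μ - B y μ) B z
  have hAB : (fun y ν => (fun y μ => A y μ - B y μ) y ν + B y ν) = A := by funext y μ; simp
  rw [hAB] at h
  rw [h]
  exact (add_sub_cancel_right _ _).symm

/-- **SUBTRACTING THE NORMAL PART LANDS IN THE SLICE** (multi-level small-field class at `W`, period `tower L N (j+1)`): if `X₀` and `Nn`
are skew, periodic, frame-free and `hsR`-orthogonal to `gaugeDir W (Ξ₀₀(W))`, and have the SAME linearised `(j+1)`-fold average, then
`X := Nn − X₀ ∈ frameFreeBlockLandauW L N (j+1) W`. [folklore] -/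
theorem sub_mem_frameFreeBlockLandauW [Nonempty n] {L N : ℕ} (hL : 1 ≤ L) (j : ℕ) {W : Site d → Fin d → (Matrix n n ℂ)ˣ} {x : ℝ}
    (hWu : IsUnitaryCfg W) (hx : 0 ≤ x) (hs : LevelSmall d L j x) (hWx : SmallField W x)
    {X₀ Nn : Site d → Fin d → (Matrix n n ℂ)} (hXs : IsSkewDir X₀) (hXP : IsPeriodicDir X₀ ((tower L N (j + 1) : ℕ) : ℤ))
    (hXF : ∀ z, framePotW L (j + 1) W X₀ z = 0)
    (hXo : ∀ μ ∈ cornerGaugeSpaceW (d := d) (n := n) L (j + 1) W (tower L N (j + 1)) (L ^ (j + 1)),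
      ∑ y ∈ periodBox (d := d) (tower L N (j + 1)), ∑ κ : Fin d, hsR (X₀ y κ) (gaugeDir W μ y κ) = 0)
    (hNs : IsSkewDir Nn) (hNP : IsPeriodicDir Nn ((tower L N (j + 1) : ℕ) : ℤ))
    (hNF : ∀ z, framePotW L (j + 1) W Nn z = 0)
    (hNo : ∀ μ ∈ cornerGaugeSpaceW (d := d) (n := n) L (j + 1) W (tower L N (j + 1)) (L ^ (j + 1)),
      ∑ y ∈ periodBox (d := d) (tower L N (j + 1)), ∑ κ : Fin d, hsR (Nn y κ) (gaugeDir W μ y κ) = 0)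
    (hD : dirIter L (j + 1) W Nn = dirIter L (j + 1) W X₀) :
    (fun y μ => Nn y μ - X₀ y μ) ∈ frameFreeBlockLandauW (d := d) (n := n) L N (j + 1) W := by
  refine ⟨fun y μ => (skewAdjoint (Matrix n n ℂ)).sub_mem (hNs y μ) (hXs y μ), fun y κ μ => ?_, ?_, fun z => ?_,
    fun μ hμ => ?_⟩
  · simp only [hNP y κ μ, hXP y κ μ]
  · show TangentIter L (j + 1 - 1) W fun y μ => Nn y μ - X₀ y μ
    rw [Nat.add_sub_cancel, tangentIter_iff_dirIter_eq_zero, dirIter_sub hL j hWu hx hs hWx, hD]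
    funext z κ; simp
  · rw [framePotW_sub hL j hWu hx hs hWx, hNF z, hXF z, sub_zero]
  · simp_rw [hsR_sub_left, Finset.sum_sub_distrib]
    rw [hNo μ hμ, hXo μ hμ, sub_zero]

/-! ## §4 The exact product split and the normal part -/

/-- **THE NORMAL PART** of the product split: `N := log(e^{X₀}·e^{X})` bondwise (`X = Nn − X₀` the tangent datum). [folklore] -/
def normalPart (X₀ X : Site d → Fin d → (Matrix n n ℂ)) : Site d → Fin d → (Matrix n n ℂ) := fun y μ => mlog (exp (X₀ y μ) * exp (X y μ))

/-- Pointwise unfolding. [folklore] -/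
theorem normalPart_apply (X₀ X : Site d → Fin d → (Matrix n n ℂ)) (y : Site d) (μ : Fin d) :
    normalPart X₀ X y μ = mlog (exp (X₀ y μ) * exp (X y μ)) := rfl

/-- **`N = Nn + logK X Nn 1 1`** when `X = Nn − X₀` (leaf-10's second logarithm `log(e^{R−b}e^{b}) − R` at `b = X`, `R = Nn`). [folklore] -/
theorem normalPart_eq_add_logK (X₀ Nn : Site d → Fin d → (Matrix n n ℂ)) (y : Site d) (μ : Fin d) :
    normalPart X₀ (fun y μ => Nn y μ - X₀ y μ) y μ = Nn y μ + logK (Nn y μ - X₀ y μ) (Nn y μ) 1 1 := by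
  simp only [normalPart, logK, one_smul]
  have h : Nn y μ - (Nn y μ - X₀ y μ) = X₀ y μ := by abel
  rw [h]; abel

/-- **THE NORMAL PART IS BILINEARLY CLOSE TO THE LINEAR NORMAL PART**: for `‖X y μ‖ < 1∕32` and `‖Nn y μ‖ < 1∕32` (`X = Nn − X₀`),
`‖N y μ − Nn y μ‖ ≤ 2048·‖X y μ‖·‖Nn y μ‖`. [folklore] -/
theorem norm_normalPart_sub_le [Nonempty n] {X₀ Nn : Site d → Fin d → (Matrix n n ℂ)} {y : Site d} {μ : Fin d}
    (hX : ‖Nn y μ - X₀ y μ‖ < 1 / 32) (hN : ‖Nn y μ‖ < 1 / 32) :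
    ‖normalPart X₀ (fun y μ => Nn y μ - X₀ y μ) y μ - Nn y μ‖ ≤ 2048 * ‖Nn y μ - X₀ y μ‖ * ‖Nn y μ‖ := by
  rw [normalPart_eq_add_logK, add_sub_cancel_left]
  have h := norm_logK_one_one_le hX hN
  have h' : 2 * (‖Nn y μ - X₀ y μ‖ / (1 / 32)) * (‖Nn y μ‖ / (1 / 32)) = 2048 * ‖Nn y μ - X₀ y μ‖ * ‖Nn y μ‖ := by ring
  linarith

/-- Sup bound of the normal part: `‖N y μ‖ ≤ (1 + 2048·α)·αN` for `‖X‖ ≤ α < 1∕32`, `‖Nn‖ ≤ αN < 1∕32`. [folklore] -/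
theorem norm_normalPart_le [Nonempty n] {X₀ Nn : Site d → Fin d → (Matrix n n ℂ)} {y : Site d} {μ : Fin d} {α αN : ℝ}
    (hX : ‖Nn y μ - X₀ y μ‖ ≤ α) (hα : α < 1 / 32) (hN : ‖Nn y μ‖ ≤ αN) (hαN : αN < 1 / 32) :
    ‖normalPart X₀ (fun y μ => Nn y μ - X₀ y μ) y μ‖ ≤ (1 + 2048 * α) * αN := by
  have h := norm_normalPart_sub_le (X₀ := X₀) (Nn := Nn) (y := y) (μ := μ) (hX.trans_lt hα) (hN.trans_lt hαN)
  have h0 : 0 ≤ ‖Nn y μ - X₀ y μ‖ := norm_nonneg _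
  have h1 : 0 ≤ ‖Nn y μ‖ := norm_nonneg _
  calc ‖normalPart X₀ (fun y μ => Nn y μ - X₀ y μ) y μ‖
      = ‖(normalPart X₀ (fun y μ => Nn y μ - X₀ y μ) y μ - Nn y μ) + Nn y μ‖ := by rw [sub_add_cancel]
    _ ≤ ‖normalPart X₀ (fun y μ => Nn y μ - X₀ y μ) y μ - Nn y μ‖ + ‖Nn y μ‖ := norm_add_le _ _
    _ ≤ 2048 * ‖Nn y μ - X₀ y μ‖ * ‖Nn y μ‖ + ‖Nn y μ‖ := by linarith
    _ ≤ 2048 * α * αN + αN := by nlinarith [mul_le_mul hX hN h1 ((norm_nonneg _).trans hX)]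
    _ = (1 + 2048 * α) * αN := by ring

/-- `‖e^{A}·e^{B} − 1‖ ≤ 1∕4` for `‖A‖, ‖B‖ ≤ 1∕32`. [folklore] -/
theorem norm_exp_mul_exp_sub_one_le [Nonempty n] {A B : (Matrix n n ℂ)} (hA : ‖A‖ ≤ 1 / 32) (hB : ‖B‖ ≤ 1 / 32) : ‖exp A * exp B - 1‖ ≤ 1 / 4 := by
  obtain ⟨hA1, -⟩ := BlockAverageLogInteraction.norm_exp_sub_one_le_two_mul hA (by norm_num)
  obtain ⟨hB1, hB2⟩ := BlockAverageLogInteraction.norm_exp_sub_one_le_two_mul hB (by norm_num)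
  have h : exp A * exp B - 1 = (exp A - 1) * exp B + (exp B - 1) := by noncomm_ring
  rw [h]
  calc ‖(exp A - 1) * exp B + (exp B - 1)‖ ≤ ‖exp A - 1‖ * ‖exp B‖ + ‖exp B - 1‖ :=
        (norm_add_le _ _).trans (add_le_add (norm_mul_le _ _) le_rfl)
    _ ≤ 2 * (1 / 32) * (1 + 2 * (1 / 32)) + 2 * (1 / 32) := by
        gcongr
    _ ≤ 1 / 4 := by norm_num

/-- **THE EXACT PRODUCT SPLIT**: `e^{N}·e^{−X} = e^{X₀}` bondwise, for `‖X₀‖, ‖X‖ ≤ 1∕32`. [folklore] -/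
theorem exp_normalPart_mul_exp_neg [Nonempty n] {X₀ X : Site d → Fin d → (Matrix n n ℂ)} {y : Site d} {μ : Fin d} (hX₀ : ‖X₀ y μ‖ ≤ 1 / 32)
    (hX : ‖X y μ‖ ≤ 1 / 32) : exp (normalPart X₀ X y μ) * exp (-X y μ) = exp (X₀ y μ) := by
  have h14 := norm_exp_mul_exp_sub_one_le hX₀ hX
  have hdisc : ‖exp (X₀ y μ) * exp (X y μ) - 1‖ < 1 := by linarith
  have h1 : exp (mlog (exp (X₀ y μ) * exp (X y μ))) = exp (X₀ y μ) * exp (X y μ) := exp_mlog hdisc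
  have h2 : exp (X y μ) * exp (-X y μ) = 1 := exp_mul_exp_neg_eq_one _
  calc exp (normalPart X₀ X y μ) * exp (-X y μ) = (exp (X₀ y μ) * exp (X y μ)) * exp (-X y μ) := by
        rw [normalPart_apply, h1]
    _ = exp (X₀ y μ) := by rw [mul_assoc, h2, mul_one]

/-- **THE NORMAL PART IS SKEW** for skew `X₀`, `X` of norm `≤ 1∕32` (the logarithm of a near-identity unitary). [folklore] -/
theorem normalPart_skew [Nonempty n] {X₀ X : Site d → Fin d → (Matrix n n ℂ)} (hX₀s : IsSkewDir X₀) (hXs : IsSkewDir X)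
    (hX₀ : ∀ y μ, ‖X₀ y μ‖ ≤ 1 / 32) (hX : ∀ y μ, ‖X y μ‖ ≤ 1 / 32) : IsSkewDir (normalPart X₀ X) := by
  intro y μ
  letI : CStarAlgebra (Matrix n n ℂ) := {}
  have h1 : exp (X₀ y μ) ∈ unitary (Matrix n n ℂ) := by simpa using exp_real_smul_mem_unitary (hX₀s y μ) 1
  have h2 : exp (X y μ) ∈ unitary (Matrix n n ℂ) := by simpa using exp_real_smul_mem_unitary (hXs y μ) 1
  have hu : exp (X₀ y μ) * exp (X y μ) ∈ unitary (Matrix n n ℂ) := (unitary (Matrix n n ℂ)).mul_mem h1 h2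
  rw [normalPart_apply, skewAdjoint.mem_iff]
  exact star_mlog_eq_neg hu (norm_exp_mul_exp_sub_one_le (hX₀ y μ) (hX y μ))

/-- **THE REPRESENTATION FIELD OF `DecomposedRep` FROM A RESIDUAL SLICE REPRESENTATIVE**: with `X := Nn − X₀` and `N := normalPart X₀ X`,
`U_A^u(b) = W(b)·e^{N(b)}·e^{−X(b)}` bondwise (sup data `≤ 1∕32`). [folklore] -/
theorem rep_of_residualSliceRep [Nonempty n] {L N k : ℕ} {W UA : Site d → Fin d → (Matrix n n ℂ)ˣ} {u : Site d → (Matrix n n ℂ)ˣ} {X₀ : Site d → Fin d → (Matrix n n ℂ)} {α₀ : ℝ}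
    (h : ResidualSliceRep L N k W UA u X₀ α₀) (hα₀ : α₀ ≤ 1 / 32) {X : Site d → Fin d → (Matrix n n ℂ)} (hX : ∀ y μ, ‖X y μ‖ ≤ 1 / 32)
    (y : Site d) (μ : Fin d) :
    ((gaugeAct u UA y μ : (Matrix n n ℂ)ˣ) : (Matrix n n ℂ)) = (W y μ : (Matrix n n ℂ)) * (exp (normalPart X₀ X y μ) * exp (-X y μ)) := by
  rw [h.rep, exp_normalPart_mul_exp_neg ((h.sup y μ).trans hα₀) (hX y μ)]
  simp [vary]

/-- **THE ALGEBRAIC HALF OF `DecomposedRep`, ASSEMBLED**: from a residual slice representative (`α₀ ≤ 1∕100`) and a normal field `Nn`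
(skew, periodic, frame-free, `Ξ₀₀(W)`-orthogonal, same linearised average as `X₀`, sup `≤ αN ≤ 1∕100`) at a background of the
multi-level small-field class: the tangent datum `X := Nn − X₀` lies in `T_♮(W)`, is skew and periodic with `‖X‖ ≤ α₀ + αN`, the
normal part `N := normalPart X₀ X` is skew and periodic with `‖N‖ ≤ (1 + 2048(α₀+αN))·αN` and `‖N − Nn‖ ≤ 2048(α₀+αN)·‖Nn‖` bondwise,
and `U_A^u = W·e^{N}·e^{−X}`. [folklore] -/
theorem decomposedRep_algebra [Nonempty n] {L N : ℕ} (hL : 1 ≤ L) (j : ℕ) {W UA : Site d → Fin d → (Matrix n n ℂ)ˣ} {x : ℝ}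
    (hWu : IsUnitaryCfg W) (hx : 0 ≤ x) (hs : LevelSmall d L j x) (hWx : SmallField W x)
    {u : Site d → (Matrix n n ℂ)ˣ} {X₀ : Site d → Fin d → (Matrix n n ℂ)} {α₀ : ℝ} (h : ResidualSliceRep L N (j + 1) W UA u X₀ α₀) (hα₀ : α₀ ≤ 1 / 100)
    {Nn : Site d → Fin d → (Matrix n n ℂ)} {αN : ℝ} (hNs : IsSkewDir Nn) (hNP : IsPeriodicDir Nn ((N * L ^ (j + 1) : ℕ) : ℤ))
    (hNF : ∀ z, framePotW L (j + 1) W Nn z = 0)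
    (hNo : ∀ μ ∈ cornerGaugeSpaceW (d := d) (n := n) L (j + 1) W (tower L N (j + 1)) (L ^ (j + 1)),
      ∑ y ∈ periodBox (d := d) (tower L N (j + 1)), ∑ κ : Fin d, hsR (Nn y κ) (gaugeDir W μ y κ) = 0)
    (hD : dirIter L (j + 1) W Nn = dirIter L (j + 1) W X₀) (hαN0 : 0 ≤ αN) (hNsup : ∀ y μ, ‖Nn y μ‖ ≤ αN)
    (hαN : αN ≤ 1 / 100) :
    (fun y μ => Nn y μ - X₀ y μ) ∈ frameFreeBlockLandauW (d := d) (n := n) L N (j + 1) W ∧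
    IsSkewDir (fun y μ => Nn y μ - X₀ y μ) ∧ IsPeriodicDir (fun y μ => Nn y μ - X₀ y μ) ((N * L ^ (j + 1) : ℕ) : ℤ) ∧
    (∀ y μ, ‖Nn y μ - X₀ y μ‖ ≤ α₀ + αN) ∧
    IsSkewDir (normalPart X₀ fun y μ => Nn y μ - X₀ y μ) ∧
    IsPeriodicDir (normalPart X₀ fun y μ => Nn y μ - X₀ y μ) ((N * L ^ (j + 1) : ℕ) : ℤ) ∧
    (∀ y μ, ‖normalPart X₀ (fun y μ => Nn y μ - X₀ y μ) y μ‖ ≤ (1 + 2048 * (α₀ + αN)) * αN) ∧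
    (∀ y μ, ‖normalPart X₀ (fun y μ => Nn y μ - X₀ y μ) y μ - Nn y μ‖ ≤ 2048 * (α₀ + αN) * ‖Nn y μ‖) ∧
    (∀ y μ, ((gaugeAct u UA y μ : (Matrix n n ℂ)ˣ) : (Matrix n n ℂ))
      = (W y μ : (Matrix n n ℂ)) * (exp (normalPart X₀ (fun y μ => Nn y μ - X₀ y μ) y μ) * exp (-(Nn y μ - X₀ y μ)))) := by
  have hXP' : IsPeriodicDir X₀ ((tower L N (j + 1) : ℕ) : ℤ) := by rw [tower_eq_mul_pow]; exact h.per
  have hNP' : IsPeriodicDir Nn ((tower L N (j + 1) : ℕ) : ℤ) := by rw [tower_eq_mul_pow]; exact hNP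
  have hmem := sub_mem_frameFreeBlockLandauW hL j hWu hx hs hWx h.skew hXP' h.frameFree h.orth hNs hNP' hNF hNo hD
  have hXsup : ∀ y μ, ‖Nn y μ - X₀ y μ‖ ≤ α₀ + αN := fun y μ =>
    (norm_sub_le _ _).trans (by rw [add_comm]; exact add_le_add (h.sup y μ) (hNsup y μ))
  have h32 : α₀ + αN < 1 / 32 := by linarith [h.hα₀]
  have hX32 : ∀ y μ, ‖Nn y μ - X₀ y μ‖ ≤ 1 / 32 := fun y μ => (hXsup y μ).trans h32.le
  have hX₀32 : ∀ y μ, ‖X₀ y μ‖ ≤ 1 / 32 := fun y μ => (h.sup y μ).trans (by linarith)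
  have hαN32 : αN < 1 / 32 := by linarith
  have hXs : IsSkewDir (fun y μ => Nn y μ - X₀ y μ) := fun y μ => (skewAdjoint (Matrix n n ℂ)).sub_mem (hNs y μ) (h.skew y μ)
  have hXP : IsPeriodicDir (fun y μ => Nn y μ - X₀ y μ) ((N * L ^ (j + 1) : ℕ) : ℤ) := fun y κ μ => by
    simp only [hNP y κ μ, h.per y κ μ]
  refine ⟨hmem, hXs, hXP, hXsup, normalPart_skew h.skew hXs hX₀32 hX32, fun y κ μ => ?_,
    fun y μ => norm_normalPart_le (hXsup y μ) h32 (hNsup y μ) hαN32, fun y μ => ?_,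
    fun y μ => rep_of_residualSliceRep h (by linarith) hX32 y μ⟩
  · simp only [normalPart, hNP y κ μ, h.per y κ μ]
  · have hb := norm_normalPart_sub_le (X₀ := X₀) (Nn := Nn) (y := y) (μ := μ) ((hXsup y μ).trans_lt h32)
      ((hNsup y μ).trans_lt hαN32)
    have h1 : 0 ≤ ‖Nn y μ‖ := norm_nonneg _
    calc ‖normalPart X₀ (fun y μ => Nn y μ - X₀ y μ) y μ - Nn y μ‖ ≤ 2048 * ‖Nn y μ - X₀ y μ‖ * ‖Nn y μ‖ := hb
      _ ≤ 2048 * (α₀ + αN) * ‖Nn y μ‖ := by nlinarith [hXsup y μ]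

end

end Summit.QuantumFields.BalabanUV.T4Continuum.NE3ResidualSliceRep
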